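import Summits.ValiantsHypothesis.ValiantsHypothesis.Theorems.KPlusLogSqLawTropicalPageRigidityMatchingK

/-!
# Route «KPlusLogSqLaw», crux `WeakLifting` (stmt-ValiantsHypothesis-19561), docket D2 — the RECOMBINATION REACH LAW: how far beyond its
# suppliers a columnwise recombination of dominant terms can reach in slope, and «no chain term is a hybrid of two earlier chain terms»

HONEST FRAMING.  Helper file (cell `pub-symmetroid`, seat val-sym-lift-p3 g25, 2026-08-29) `--supports` the crux
`Summit.ValiantsHypothesis.ValiantsHypothesis.Theses.KPlusLogSqLaw.WeakLifting` (ledger item `stmt-ValiantsHypothesis-19561`, route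
`KPlusLogSqLaw`; lineage docket D2 = the `K = 4` tropical exponent fork).  STRUCTURE laws for dominant terms of an ARBITRARY design (any format,
any exponents — NOT a lex-regime statement), motivated by the located FRESH-INCIDENCE census of this seat (memo
HOME/val-sym-lift-p3/g25/memo/GRADED-PAGES-AND-SEPARABILITY-liftp3g25.md §3b: along every kernel census chain of the `K = 4` column almost every
step brings a never-used incidence, and the few «zero-fresh» steps are columnwise recombinations of 3–5 EARLIER terms, never of 2).  Nothing here
bounds a tropical row or asserts anything about `WeakLifting`, `TropicalB`, `Lifting`, `KPlusLogSqLaw`, `MatrixDescartes` (stmt-ValiantsHypothesis-18050)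
or VP ≠ VNP.

THE LAW.  Let `t₀, …, t_k` be dominant at slopes `θ₀ < ⋯ < θ_k` and let `M` choose in each column one of the entries of the `t`'s with bijective
rows (a columnwise RECOMBINATION; `slope d p = Σ_i d (p.2 i)`), `M ≠ t_r` for all `r`.  Then
  `(θ_k − θ₀) · slope M < Σ_r (θ_r − θ₀) · slope t_r`      (`reach_lt`).
Proof: König re-assembly of the leftover (`pageRigid_konig`, p494347) makes `M` a member of a columnwise re-decomposition of the `t`'s; index it
at the LAST slot; the exchange lemma `sum_mul_slope_lt_of_redecomp` gives `Σ θ_r slope u_r < Σ θ_r slope t_r`, the total slope is preserved, and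
after subtracting `θ₀ ·` total the other members contribute nonnegative amounts.  Consequences:
* `k = 1` (two suppliers): `slope M < slope t₁` — so along a dominant chain NO term is a columnwise hybrid of TWO EARLIER terms
  (`not_hybrid_of_two_earlier`; slopes strictly increase along the chain).  A «zero-fresh» step therefore draws on ≥ 3 earlier terms.
* `k = 2`: `slope M − slope t₂ < ((θ₁ − θ₀)/(θ₂ − θ₀))·slope t₁` — the reach beyond the last supplier is throttled by how early the middle
  supplier sits (`reach_lt` read with three terms); in general the reach is a θ-weighted average of the suppliers' slopes.
* `not_hybrid_of_two_later` — nor is a chain term a hybrid of two LATER terms (component exchange law twice); a chain term is a columnwise hybrid of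
  two other chain terms only when they STRADDLE it.
* chain form `reach_lt_chain` (pairwise distinct chain terms, e.g. sign-alternating — `stub_dominantInjective`): for chain positions `a₀ < ⋯ < a_k` all earlier than `x` with `p x` recombined from the `p (a r)`,
  `(θ (a k) − θ (a 0))·slope (p x) < Σ_r (θ (a r) − θ (a 0))·slope (p (a r))`.
[folklore exchange / LP-duality reasoning; König packaging = the tree's p494347; the statements are the cell's]
-/

set_option linter.dupNamespace false
set_option autoImplicit false

namespace Summit.ValiantsHypothesis.ValiantsHypothesis.Theorems.KPlusLogSqLaw

open Summit.ValiantsHypothesis.ValiantsHypothesis.Theorems.MatrixDescartes.Negative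
open Summit.ValiantsHypothesis.ValiantsHypothesis.Theorems.LacunarySymmetroidMatrixDescartes.TropicalCensus
open scoped BigOperators
open Finset

namespace RecombinationReach

variable {m K : ℕ}

/-- slopes are nonnegative. -/
theorem slope_nonneg (d : Fin K → ℕ) (p : Equiv.Perm (Fin m) × (Fin m → Fin K)) : 0 ≤ slope d p := by
  unfold LacunarySymmetroidMatrixDescartes.TropicalCensus.slope
  exact sum_nonneg fun i _ => by positivity

/-- **RECOMBINATION REACH LAW.**  `t₀..t_k` dominant at strictly increasing slopes; `M` a columnwise recombination of them with bijective rows,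
different from every `t_r`.  Then `(θ_k − θ₀)·slope M < Σ_r (θ_r − θ₀)·slope t_r`. -/
theorem reach_lt {k : ℕ} (d : Fin K → ℕ) (v ε : Fin m → Fin m → Fin K → ℤ)
    (θ : Fin (k + 1) → ℤ) (hθ : StrictMono θ) (t : Fin (k + 1) → Equiv.Perm (Fin m) × (Fin m → Fin K))
    (hdom : ∀ r, IsDominant d v ε (θ r) (t r))
    (sel : Fin m → Fin (k + 1)) (hbij : Function.Bijective fun i => (t (sel i)).1 i)
    (hM : ∀ r, ((Equiv.ofBijective _ hbij, fun i => (t (sel i)).2 i) : Equiv.Perm (Fin m) × (Fin m → Fin K)) ≠ t r) :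
    (θ (Fin.last k) - θ 0) * slope d (Equiv.ofBijective _ hbij, fun i => (t (sel i)).2 i)
      < ∑ r, (θ r - θ 0) * slope d (t r) := by
  classical
  -- the layers and their regularity (as in `classCount_eq_of_recombination`)
  let e : Fin (k + 1) → Fin m → Fin m × Fin K := fun j i => ((t j).1 i, (t j).2 i)
  have hreg : ∀ a : Fin m, ((univ : Finset (Fin (k + 1) × Fin m)).filter fun p => (e p.1 p.2).1 = a).card = k + 1 := by
    intro a
    have h : ((univ : Finset (Fin (k + 1) × Fin m)).filter fun p => (e p.1 p.2).1 = a)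
        = (univ : Finset (Fin (k + 1))).image (fun j => (j, ((t j).1).symm a)) := by
      ext p
      simp only [mem_filter, mem_univ, true_and, mem_image, e]
      constructor
      · intro hp
        refine ⟨p.1, ?_⟩
        have : ((t p.1).1).symm a = p.2 := by rw [← hp]; simp
        rw [this]
      · rintro ⟨j, rfl⟩
        simp
    rw [h, card_image_of_injective _ (fun j j' hjj' => (Prod.mk.inj hjj').1)]
    simp
  have hbij' : Function.Bijective fun i => (e (sel i) i).1 := hbij
  let e' : Fin k → Fin m → Fin m × Fin K := fun j i => e ((sel i).succAbove j) i
  have hreg' := pageRigid_leftover_regular e hreg sel hbij'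
  obtain ⟨u', hu'⟩ := pageRigid_konig k e' hreg'
  set M : Equiv.Perm (Fin m) × (Fin m → Fin K) := (Equiv.ofBijective _ hbij, fun i => (t (sel i)).2 i) with hMdef
  let U : Fin (k + 1) → Equiv.Perm (Fin m) × (Fin m → Fin K) := Fin.cons M u'
  have hcol : ∀ i : Fin m, (univ : Finset (Fin (k + 1))).val.map (fun r => ((U r).1 i, (U r).2 i)) =
      (univ : Finset (Fin (k + 1))).val.map (fun r => ((t r).1 i, (t r).2 i)) := by
    intro i
    have hL : (univ : Finset (Fin (k + 1))).val.map (fun r => ((U r).1 i, (U r).2 i))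
        = e (sel i) i ::ₘ (univ : Finset (Fin k)).val.map (fun j => e' j i) := by
      rw [Fin.univ_succ, cons_val, Multiset.map_cons, map_val, Multiset.map_map]
      congr 1
      rw [← hu' i]
      rfl
    have hR : (univ : Finset (Fin (k + 1))).val.map (fun r => ((t r).1 i, (t r).2 i))
        = e (sel i) i ::ₘ (univ : Finset (Fin k)).val.map (fun j => e' j i) := by
      rw [Fin.univ_succAbove k (sel i), cons_val, Multiset.map_cons, map_val, Multiset.map_map]
      rfl
    rw [hL, hR]
  -- re-index so that `M` sits in the LAST slot
  let π : Equiv.Perm (Fin (k + 1)) := Equiv.swap 0 (Fin.last k)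
  let U' : Fin (k + 1) → Equiv.Perm (Fin m) × (Fin m → Fin K) := fun r => U (π r)
  have hU'last : U' (Fin.last k) = M := by
    show U (Equiv.swap 0 (Fin.last k) (Fin.last k)) = M
    rw [Equiv.swap_apply_right]; rfl
  have hcol' : ∀ i : Fin m, (univ : Finset (Fin (k + 1))).val.map (fun r => ((U' r).1 i, (U' r).2 i)) =
      (univ : Finset (Fin (k + 1))).val.map (fun r => ((t r).1 i, (t r).2 i)) := by
    intro i; rw [← hcol i]; exact pageRigid_colMultiset_comp_equiv U π i
  have hne : U' ≠ t := by
    intro h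
    have := congrFun h (Fin.last k)
    rw [hU'last] at this
    exact hM _ this
  have hlt := sum_mul_slope_lt_of_redecomp d v ε θ t U' hdom hcol' hne
  -- total slope is preserved
  have htot : ∑ r, slope d (U' r) = ∑ r, slope d (t r) := by
    unfold LacunarySymmetroidMatrixDescartes.TropicalCensus.slope
    exact pageRigid_sum_colfun_eq_of_redecomp t U' hcol' (fun _ l => (d l : ℤ))
  -- subtract `θ 0 ·` total and drop the nonnegative middle members
  have h1 : ∑ r, (θ r - θ 0) * slope d (U' r) < ∑ r, (θ r - θ 0) * slope d (t r) := by
    have hL : ∑ r, (θ r - θ 0) * slope d (U' r) = ∑ r, θ r * slope d (U' r) - θ 0 * ∑ r, slope d (U' r) := by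
      rw [mul_sum, ← sum_sub_distrib]; exact sum_congr rfl fun r _ => by ring
    have hR : ∑ r, (θ r - θ 0) * slope d (t r) = ∑ r, θ r * slope d (t r) - θ 0 * ∑ r, slope d (t r) := by
      rw [mul_sum, ← sum_sub_distrib]; exact sum_congr rfl fun r _ => by ring
    rw [hL, hR, htot]
    linarith
  have h2 : (θ (Fin.last k) - θ 0) * slope d M ≤ ∑ r, (θ r - θ 0) * slope d (U' r) := by
    rw [Fin.sum_univ_castSucc, hU'last]
    have hnn : 0 ≤ ∑ r : Fin k, (θ r.castSucc - θ 0) * slope d (U' r.castSucc) :=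
      sum_nonneg fun r _ => mul_nonneg (sub_nonneg.mpr (hθ.monotone (Fin.zero_le _))) (slope_nonneg d _)
    linarith
  exact lt_of_le_of_lt h2 h1

/-- **Chain form.**  Along a chain of pairwise distinct terms dominant at strictly increasing slopes, if the term at position `x` is a columnwise
recombination of the terms at earlier positions `a 0 < a 1 < ⋯ < a k < x` (`a` strictly monotone, `a (Fin.last k) < x`), then
`(θ (a k) − θ (a 0))·slope (p x) < Σ_r (θ (a r) − θ (a 0))·slope (p (a r))`. -/
theorem reach_lt_chain {n k : ℕ} (d : Fin K → ℕ) (v ε : Fin m → Fin m → Fin K → ℤ)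
    (θ : Fin (n + 1) → ℤ) (hθ : StrictMono θ) (p : Fin (n + 1) → Equiv.Perm (Fin m) × (Fin m → Fin K))
    (hdom : ∀ r, IsDominant d v ε (θ r) (p r)) (hinj : Function.Injective p)
    (a : Fin (k + 1) → Fin (n + 1)) (ha : StrictMono a) (x : Fin (n + 1)) (hax : a (Fin.last k) < x)
    (hrec : ∀ i, ∃ r, ((p (a r)).1 i, (p (a r)).2 i) = ((p x).1 i, (p x).2 i)) :
    (θ (a (Fin.last k)) - θ (a 0)) * slope d (p x) < ∑ r, (θ (a r) - θ (a 0)) * slope d (p (a r)) := by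
  classical
  choose sel hsel using hrec
  have hsel1 : ∀ i, (p (a (sel i))).1 i = (p x).1 i := fun i => (Prod.mk.inj (hsel i)).1
  have hsel2 : ∀ i, (p (a (sel i))).2 i = (p x).2 i := fun i => (Prod.mk.inj (hsel i)).2
  have hbij : Function.Bijective fun i => ((p ∘ a) (sel i)).1 i := by
    have : (fun i => ((p ∘ a) (sel i)).1 i) = (p x).1 := funext hsel1
    rw [this]; exact (p x).1.bijective
  have hMx : ((Equiv.ofBijective _ hbij, fun i => ((p ∘ a) (sel i)).2 i) : Equiv.Perm (Fin m) × (Fin m → Fin K)) = p x := by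
    refine Prod.ext ?_ ?_
    · ext i; exact congrArg Fin.val (hsel1 i)
    · funext i; exact hsel2 i
  -- `p x` differs from every earlier term: slopes strictly increase along the chain
  have hsx : ∀ r, slope d (p (a r)) < slope d (p x) := by
    intro r
    have har : a r < x := lt_of_le_of_lt (ha.monotone (Fin.le_last r)) hax
    have h := sum_lt_sum_of_swap_chain d v ε θ p hθ hdom har univ (by simp) ?_
    · simpa [LacunarySymmetroidMatrixDescartes.TropicalCensus.slope] using h
    · by_contra hall
      push Not at hall
      have heq : p (a r) = p x := by
        refine Prod.ext (Equiv.ext fun i => ?_) (funext fun i => ?_)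
        · exact (Prod.mk.inj (hall i (mem_univ i))).1
        · exact (Prod.mk.inj (hall i (mem_univ i))).2
      exact absurd (hinj heq) (ne_of_lt har)
  have hM : ∀ r, ((Equiv.ofBijective _ hbij, fun i => ((p ∘ a) (sel i)).2 i) : Equiv.Perm (Fin m) × (Fin m → Fin K)) ≠ (p ∘ a) r := by
    intro r h
    rw [hMx] at h
    exact absurd (congrArg (slope d) h) (ne_of_gt (hsx r))
  have h := reach_lt d v ε (θ ∘ a) (hθ.comp ha) (p ∘ a) (fun r => hdom (a r)) sel hbij hM
  rw [hMx] at h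
  simpa using h

/-- **No chain term is a hybrid of two earlier chain terms.**  For positions `a < b < x` of a chain of pairwise distinct dominant terms, the term at
`x` is not obtained by choosing in each column the entry of the term at `a` or the entry of the term at `b` — a «zero-fresh» step draws on at
least three earlier terms. -/
theorem not_hybrid_of_two_earlier {n : ℕ} (d : Fin K → ℕ) (v ε : Fin m → Fin m → Fin K → ℤ)
    (θ : Fin (n + 1) → ℤ) (hθ : StrictMono θ) (p : Fin (n + 1) → Equiv.Perm (Fin m) × (Fin m → Fin K))
    (hdom : ∀ r, IsDominant d v ε (θ r) (p r)) (hinj : Function.Injective p)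
    {a b x : Fin (n + 1)} (hab : a < b) (hbx : b < x) :
    ¬ (∀ i, ((p a).1 i, (p a).2 i) = ((p x).1 i, (p x).2 i) ∨ ((p b).1 i, (p b).2 i) = ((p x).1 i, (p x).2 i)) := by
  intro h
  let ab : Fin 2 → Fin (n + 1) := ![a, b]
  have hmono : StrictMono ab := by
    rw [Fin.strictMono_iff_lt_succ]
    intro i
    fin_cases i
    simpa [ab] using hab
  have hrec : ∀ i, ∃ r, ((p (ab r)).1 i, (p (ab r)).2 i) = ((p x).1 i, (p x).2 i) := by
    intro i
    rcases h i with hi | hi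
    · exact ⟨0, by simpa [ab] using hi⟩
    · exact ⟨1, by simpa [ab] using hi⟩
  have hlt := reach_lt_chain d v ε θ hθ p hdom hinj ab hmono x (by simpa [ab] using hbx) hrec
  -- with two suppliers the law reads `(θ b − θ a)·slope (p x) < (θ b − θ a)·slope (p b)`, but `slope (p b) < slope (p x)`
  have hsum : ∑ r : Fin 2, (θ (ab r) - θ (ab 0)) * slope d (p (ab r)) = (θ b - θ a) * slope d (p b) := by
    simp [Fin.sum_univ_two, ab]
  have hlast : (θ (ab (Fin.last 1)) - θ (ab 0)) = θ b - θ a := by simp [ab]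
  rw [hsum, hlast] at hlt
  have hθab : 0 < θ b - θ a := sub_pos.mpr (hθ hab)
  have hsx : slope d (p b) < slope d (p x) := by
    have h := sum_lt_sum_of_swap_chain d v ε θ p hθ hdom hbx univ (by simp) ?_
    · simpa [LacunarySymmetroidMatrixDescartes.TropicalCensus.slope] using h
    · by_contra hall
      push Not at hall
      have heq : p b = p x := by
        refine Prod.ext (Equiv.ext fun i => ?_) (funext fun i => ?_)
        · exact (Prod.mk.inj (hall i (mem_univ i))).1
        · exact (Prod.mk.inj (hall i (mem_univ i))).2
      exact absurd (hinj heq) (ne_of_lt hbx)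
  nlinarith

/-- **No chain term is a hybrid of two later chain terms either.**  For positions `x < b < c` of a chain of pairwise distinct dominant terms, the
term at `x` is not obtained by choosing in each column the entry of the term at `b` or of the term at `c`.  (Two applications of the component
exchange law `sum_lt_sum_of_swap_chain` on the column set where `p x` agrees with `p c`: there both `(x, b)` and `(b, c)` have equal row sets.)
So a chain term is a columnwise hybrid of two other chain terms only if they STRADDLE it. -/
theorem not_hybrid_of_two_later {n : ℕ} (d : Fin K → ℕ) (v ε : Fin m → Fin m → Fin K → ℤ)
    (θ : Fin (n + 1) → ℤ) (hθ : StrictMono θ) (p : Fin (n + 1) → Equiv.Perm (Fin m) × (Fin m → Fin K))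
    (hdom : ∀ r, IsDominant d v ε (θ r) (p r)) (hinj : Function.Injective p)
    {x b c : Fin (n + 1)} (hxb : x < b) (hbc : b < c) :
    ¬ (∀ i, ((p b).1 i, (p b).2 i) = ((p x).1 i, (p x).2 i) ∨ ((p c).1 i, (p c).2 i) = ((p x).1 i, (p x).2 i)) := by
  classical
  intro h
  -- `C` = the columns where `p x` takes the entry of `p c`
  set C : Finset (Fin m) := univ.filter fun i => ((p c).1 i, (p c).2 i) = ((p x).1 i, (p x).2 i) with hC
  have hxc : ∀ i ∈ C, ((p x).1 i, (p x).2 i) = ((p c).1 i, (p c).2 i) := fun i hi => ((mem_filter.mp hi).2).symm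
  have hxb' : ∀ i, i ∉ C → ((p x).1 i, (p x).2 i) = ((p b).1 i, (p b).2 i) := by
    intro i hi
    rcases h i with h1 | h2
    · exact h1.symm
    · have hiC : i ∈ C := by rw [hC]; exact mem_filter.mpr ⟨mem_univ i, h2⟩
      exact absurd hiC hi
  -- row sets on `C`: all three agree (complements of the common part off `C`)
  have himg_xc : C.image (p x).1 = C.image (p c).1 := by
    apply image_congr
    intro i hi; exact (Prod.mk.inj (hxc i hi)).1
  have hcompl : ∀ (σ τ : Equiv.Perm (Fin m)), (∀ i, i ∉ C → σ i = τ i) → C.image σ = C.image τ := by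
    intro σ τ hστ
    have hσ : C.image σ = univ \ (Cᶜ).image σ := by
      ext y
      simp only [mem_image, mem_sdiff, mem_univ, true_and, mem_compl]
      constructor
      · rintro ⟨i, hi, rfl⟩
        rintro ⟨j, hj, hji⟩
        exact hj (by rwa [σ.injective hji])
      · intro hy
        obtain ⟨i, rfl⟩ := σ.surjective y
        by_cases hi : i ∈ C
        · exact ⟨i, hi, rfl⟩
        · exact absurd ⟨i, hi, rfl⟩ hy
    have hτ : C.image τ = univ \ (Cᶜ).image τ := by
      ext y
      simp only [mem_image, mem_sdiff, mem_univ, true_and, mem_compl]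
      constructor
      · rintro ⟨i, hi, rfl⟩
        rintro ⟨j, hj, hji⟩
        exact hj (by rwa [τ.injective hji])
      · intro hy
        obtain ⟨i, rfl⟩ := τ.surjective y
        by_cases hi : i ∈ C
        · exact ⟨i, hi, rfl⟩
        · exact absurd ⟨i, hi, rfl⟩ hy
    rw [hσ, hτ]
    congr 1
    apply image_congr
    intro i hi; exact hστ i (mem_compl.mp hi)
  have himg_xb : C.image (p x).1 = C.image (p b).1 :=
    hcompl _ _ fun i hi => (Prod.mk.inj (hxb' i hi)).1
  have himg_bc : C.image (p b).1 = C.image (p c).1 := himg_xb.symm.trans himg_xc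
  -- `p b` and `p x` differ somewhere on `C` (else `p x = p b`)
  have hdiff_xb : ∃ i ∈ C, ((p x).1 i, (p x).2 i) ≠ ((p b).1 i, (p b).2 i) := by
    by_contra hall
    push Not at hall
    have heq : p x = p b := by
      refine Prod.ext (Equiv.ext fun i => ?_) (funext fun i => ?_)
      · by_cases hi : i ∈ C
        · exact (Prod.mk.inj (hall i hi)).1
        · exact (Prod.mk.inj (hxb' i hi)).1
      · by_cases hi : i ∈ C
        · exact (Prod.mk.inj (hall i hi)).2
        · exact (Prod.mk.inj (hxb' i hi)).2
    exact absurd (hinj heq) (ne_of_lt hxb)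
  have hdiff_bc : ∃ i ∈ C, ((p b).1 i, (p b).2 i) ≠ ((p c).1 i, (p c).2 i) := by
    obtain ⟨i, hi, hne⟩ := hdiff_xb
    exact ⟨i, hi, fun hh => hne (by rw [hxc i hi, hh])⟩
  -- two applications of the component law on `C`
  have h1 := sum_lt_sum_of_swap_chain d v ε θ p hθ hdom hxb C himg_xb hdiff_xb
  have h2 := sum_lt_sum_of_swap_chain d v ε θ p hθ hdom hbc C himg_bc hdiff_bc
  have h3 : ∑ i ∈ C, (d ((p x).2 i) : ℤ) = ∑ i ∈ C, (d ((p c).2 i) : ℤ) :=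
    sum_congr rfl fun i hi => by rw [(Prod.mk.inj (hxc i hi)).2]
  linarith

end RecombinationReach

end Summit.ValiantsHypothesis.ValiantsHypothesis.Theorems.KPlusLogSqLaw
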